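import Summits.CriticalPhenomena.PercolationContinuityZ3.Theorems.PercNearOneGluingNoHeavyLowerTailSahiE3Hit3PatternFlows
import Mathlib.Data.Fintype.Pi
import Mathlib.Data.Fin.VecNotation
import Mathlib.Tactic.Linarith
import Mathlib.Tactic.FinCases
import HarnessLib
import HarnessLib.Audit

/-!
# `NoHeavyLowerTail` (crux stmt-CriticalPhenomena-4575), Sahi programme P4 (Holley / monotone coupling):
# the `1+2+3` slot certificate on the pattern `2³` — combinatorial interface, appendix: the consequences of log-supermodularity

Support file (cell `prim-l12`, seat P4, generation 10; `--supports stmt-CriticalPhenomena-4575`).  No named facts, no sorries;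
standard axioms; def-free; no notation (the slot set is passed as `(M, hM : M = {100, 010, 001, 110, 101, 011, 111})`).  Notation and context as in `…SahiE3Hit3PatternRows`.

`facts_of_pattern`: the consequences of log-supermodularity of a weight `ν ≥ 0` on `2³` consumed by the real-algebra files
`…SahiE3Hit3Alg*` (exactly the facts used by the machine-found certificates, HOME prim-l12-p4/code/gen10/x23): nonnegativity,
`Z = Σ n`, point conditions (incomparable pairs), FKG products of up-sets (four functions theorem via `fkg_upperSet_mass`), and the
Ahlswede–Daykin trace inequalities `u·n(T ∖ OP) ≤ d·n(T ∩ OP)` (`…SahiE3PatternReduction.mass_U_mul_trace_compl_le`).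
-/

namespace Summit.CriticalPhenomena.PercolationContinuityZ3.Theorems.SahiE3Hit3Pattern

open Finset
open scoped BigOperators

/-- **The consequences of log-supermodularity on `2³` used by the real-algebra files** (`…SahiE3Hit3Alg*`): nonnegativity,
`Z` = total mass, point conditions, FKG products of up-sets (four functions theorem [Ahlswede–Daykin] via `fkg_upperSet_mass`),
and Ahlswede–Daykin trace inequalities (`…SahiE3PatternReduction.mass_U_mul_trace_compl_le`). [this work] -/
theorem facts_of_pattern (ν : (Fin 3 → Bool) → ℝ) (hν0 : ∀ t, 0 ≤ ν t) (hν : ∀ a b, ν a * ν b ≤ ν (a ⊓ b) * ν (a ⊔ b))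
    (nE n0 n1 n2 n01 n02 n12 nT Z : ℝ) (hZ : ∑ t, ν t = Z)
    (hE : ν ![false, false, false] = nE) (h0 : ν ![true, false, false] = n0) (h1 : ν ![false, true,
        false] = n1) (h2 : ν ![false, false, true] = n2) (h01 : ν ![true, true, false] = n01) (h02 : ν ![true, false,
        true] = n02) (h12 : ν ![false, true, true] = n12) (hT : ν ![true, true, true] = nT) :
      0 ≤ nE ∧
      0 ≤ n0 ∧
      0 ≤ n1 ∧
      0 ≤ n2 ∧
      0 ≤ n01 ∧
      0 ≤ n02 ∧
      0 ≤ n12 ∧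
      0 ≤ nT ∧
      0 ≤ Z ∧
      Z = (nE + n0 + n1 + n2 + n01 + n02 + n12 + nT) ∧
      n0 * n1 ≤ nE * n01 ∧
      n0 * n2 ≤ nE * n02 ∧
      n1 * n2 ≤ nE * n12 ∧
      (n01 + nT) * (n2 + n02 + n12 + nT) ≤ Z * nT ∧
      (n02 + nT) * (n1 + n01 + n12 + nT) ≤ Z * nT ∧
      (n0 + n01 + n02 + nT) * (n12 + nT) ≤ Z * nT ∧
      (n0 + n01 + n02 + nT) * (n1 + n01 + n12 + nT) ≤ Z * (n01 + nT) ∧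
      (n0 + n01 + n02 + nT) * (n2 + n02 + n12 + nT) ≤ Z * (n02 + nT) ∧
      (n0 + n01 + n02 + nT) * (n1 + n2 + n01 + n02 + n12 + nT) ≤ Z * (n01 + n02 + nT) ∧
      (n1 + n01 + n12 + nT) * (n2 + n02 + n12 + nT) ≤ Z * (n12 + nT) ∧
      (n1 + n01 + n12 + nT) * (n0 + n2 + n01 + n02 + n12 + nT) ≤ Z * (n01 + n12 + nT) ∧
      (n0 + n01 + n02 + n12 + nT) * (n1 + n2 + n01 + n02 + n12 + nT) ≤ Z * (n01 + n02 + n12 + nT) ∧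
      (n1 + n01 + n02 + n12 + nT) * (n0 + n2 + n01 + n02 + n12 + nT) ≤ Z * (n01 + n02 + n12 + nT) ∧
      (n0 + n1 + n01 + n02 + n12 + nT) * (n2 + n02 + n12 + nT) ≤ Z * (n02 + n12 + nT) ∧
      (n0 + n1 + n01 + n02 + n12 + nT) * (n2 + n01 + n02 + n12 + nT) ≤ Z * (n01 + n02 + n12 + nT) ∧
      (n0 + n1 + n01 + n02 + n12 + nT) * (n0 + n2 + n01 + n02 + n12 + nT) ≤ Z * (n0 + n01 + n02 + n12 + nT) ∧
      (n0 + n1 + n01 + n02 + n12 + nT) * (n1 + n2 + n01 + n02 + n12 + nT) ≤ Z * (n1 + n01 + n02 + n12 + nT) ∧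
      (n0 + n2 + n01 + n02 + n12 + nT) * (n1 + n2 + n01 + n02 + n12 + nT) ≤ Z * (n2 + n01 + n02 + n12 + nT) := by
  letI : DecidableLE (Fin 3 → Bool) := fun a b => inferInstanceAs (Decidable (∀ i, a i ≤ b i))
  have hν0' : 0 ≤ ν := fun t => hν0 t
  -- point conditions
  have pt : ∀ a b c d : Fin 3 → Bool, a ⊓ b = c → a ⊔ b = d → ν a * ν b ≤ ν c * ν d := by
    rintro a b c d rfl rfl; exact hν a b
  have hUc : ({![true, false, false], ![false, true, false], ![false, false, true], ![true, true, false], ![true,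
      false, true], ![false, true, true], ![true, true, true]} : Finset (Fin 3 → Bool))ᶜ = ({![false, false,
      false]} : Finset (Fin 3 → Bool)) := by decide
  have huniv : (univ : Finset (Fin 3 → Bool)) = {![false, false, false], ![true, false, false], ![false, true,
      false], ![false, false, true], ![true, true, false], ![true, false, true], ![false, true, true], ![true, true,
      true]} := by decide
  have hZ' : Literature.Probability.LatticeModels.mass ν univ = Z := by
    rw [Literature.Probability.LatticeModels.mass_univ, hZ]
  have hsum : Z = (nE + n0 + n1 + n2 + n01 + n02 + n12 + nT) := by
    rw [← hZ, huniv, Finset.sum_insert (by simp), Finset.sum_insert (by simp), Finset.sum_insert (by simp),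
      Finset.sum_insert (by simp), Finset.sum_insert (by simp), Finset.sum_insert (by simp),
          Finset.sum_insert (by simp),
      Finset.sum_singleton, hE, h0, h1, h2, h01, h02, h12, hT]
    ring
  -- FKG products of up-sets
  have fkg : ∀ S S' W : Finset (Fin 3 → Bool), (∀ a b : Fin 3 → Bool, a ≤ b → a ∈ S → b ∈ S) →
      (∀ a b : Fin 3 → Bool, a ≤ b → a ∈ S' → b ∈ S') → S ∩ S' = W →
      (∑ t ∈ S, ν t) * (∑ t ∈ S', ν t) ≤ Z * ∑ t ∈ W, ν t := by
    rintro S S' W hS hS' rfl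
    have h := Literature.Probability.LatticeModels.fkg_upperSet_mass hν0' hν (A := S) (B := S')
      (fun a b hab ha => hS a b hab ha) (fun a b hab ha => hS' a b hab ha)
    rw [hZ'] at h
    exact h
  -- Ahlswede–Daykin trace inequalities
  have ad : ∀ T V W : Finset (Fin 3 → Bool), (∀ a b : Fin 3 → Bool, a ≤ b → a ∈ T → b ∈ T) →
      T ∩ ({![true, false, false], ![false, true, false], ![false, false, true], ![true, true, false], ![true, false,
          true], ![false, true, true], ![true, true, true]} : Finset (Fin 3 → Bool))ᶜ = V → T ∩ ({![true, false,
          false], ![false, true, false], ![false, false, true], ![true, true, false], ![true, false, true], ![false,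
          true, true], ![true, true, true]} : Finset (Fin 3 → Bool)) = W →
      (∑ t ∈ ({![true, false, false], ![false, true, false], ![false, false, true], ![true, true, false], ![true,
          false, true], ![false, true, true], ![true, true, true]} : Finset (Fin 3 → Bool)), ν t) * (∑ s ∈ V,
          ν s) ≤ (∑ s ∈ ({![true, false, false], ![false, true, false], ![false, false, true], ![true, true, false],
          ![true, false, true], ![false, true, true], ![true, true, true]} : Finset (Fin 3 → Bool))ᶜ,
          ν s) * (∑ t ∈ W, ν t) := by
    rintro T V W hT' rfl rfl
    exact SahiE3PatternReduction.mass_U_mul_trace_compl_le hν0' hν (isUpperSet_hit3 _ rfl) fun a b hab ha =>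
      hT' a b hab ha
  -- masses of the relevant sets
  have m_01_T : ∑ t ∈ ({![true, true, false], ![true, true, true]} : Finset (Fin 3 → Bool)), ν t = n01 + nT := by
    rw [Finset.sum_insert (by simp), Finset.sum_singleton, h01, hT]
  have m_2_02_12_T : ∑ t ∈ ({![false, false, true], ![true, false, true], ![false, true, true], ![true, true,
      true]} : Finset (Fin 3 → Bool)), ν t = n2 + n02 + n12 + nT := by
    rw [Finset.sum_insert (by simp), Finset.sum_insert (by simp), Finset.sum_insert (by simp), Finset.sum_singleton,
        h2, h02, h12, hT]; ring
  have m_T : ∑ t ∈ ({![true, true, true]} : Finset (Fin 3 → Bool)), ν t = nT := by rw [Finset.sum_singleton, hT]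
  have m_02_T : ∑ t ∈ ({![true, false, true], ![true, true, true]} : Finset (Fin 3 → Bool)), ν t = n02 + nT := by
    rw [Finset.sum_insert (by simp), Finset.sum_singleton, h02, hT]
  have m_1_01_12_T : ∑ t ∈ ({![false, true, false], ![true, true, false], ![false, true, true], ![true, true,
      true]} : Finset (Fin 3 → Bool)), ν t = n1 + n01 + n12 + nT := by
    rw [Finset.sum_insert (by simp), Finset.sum_insert (by simp), Finset.sum_insert (by simp), Finset.sum_singleton,
        h1, h01, h12, hT]; ring
  have m_0_01_02_T : ∑ t ∈ ({![true, false, false], ![true, true, false], ![true, false, true], ![true, true,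
      true]} : Finset (Fin 3 → Bool)), ν t = n0 + n01 + n02 + nT := by
    rw [Finset.sum_insert (by simp), Finset.sum_insert (by simp), Finset.sum_insert (by simp), Finset.sum_singleton,
        h0, h01, h02, hT]; ring
  have m_12_T : ∑ t ∈ ({![false, true, true], ![true, true, true]} : Finset (Fin 3 → Bool)), ν t = n12 + nT := by
    rw [Finset.sum_insert (by simp), Finset.sum_singleton, h12, hT]
  have m_1_2_01_02_12_T : ∑ t ∈ ({![false, true, false], ![false, false, true], ![true, true, false], ![true, false,
      true], ![false, true, true], ![true, true, true]} : Finset (Fin 3 → Bool)),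
      ν t = n1 + n2 + n01 + n02 + n12 + nT := by
    rw [Finset.sum_insert (by simp), Finset.sum_insert (by simp), Finset.sum_insert (by simp),
        Finset.sum_insert (by simp), Finset.sum_insert (by simp), Finset.sum_singleton, h1, h2, h01, h02, h12,
        hT]; ring
  have m_01_02_T : ∑ t ∈ ({![true, true, false], ![true, false, true], ![true, true, true]} : Finset (Fin 3 → Bool)),
      ν t = n01 + n02 + nT := by
    rw [Finset.sum_insert (by simp), Finset.sum_insert (by simp), Finset.sum_singleton, h01, h02, hT]; ring
  have m_0_2_01_02_12_T : ∑ t ∈ ({![true, false, false], ![false, false, true], ![true, true, false], ![true, false,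
      true], ![false, true, true], ![true, true, true]} : Finset (Fin 3 → Bool)),
      ν t = n0 + n2 + n01 + n02 + n12 + nT := by
    rw [Finset.sum_insert (by simp), Finset.sum_insert (by simp), Finset.sum_insert (by simp),
        Finset.sum_insert (by simp), Finset.sum_insert (by simp), Finset.sum_singleton, h0, h2, h01, h02, h12,
        hT]; ring
  have m_01_12_T : ∑ t ∈ ({![true, true, false], ![false, true, true], ![true, true, true]} : Finset (Fin 3 → Bool)),
      ν t = n01 + n12 + nT := by
    rw [Finset.sum_insert (by simp), Finset.sum_insert (by simp), Finset.sum_singleton, h01, h12, hT]; ring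
  have m_0_01_02_12_T : ∑ t ∈ ({![true, false, false], ![true, true, false], ![true, false, true], ![false, true,
      true], ![true, true, true]} : Finset (Fin 3 → Bool)), ν t = n0 + n01 + n02 + n12 + nT := by
    rw [Finset.sum_insert (by simp), Finset.sum_insert (by simp), Finset.sum_insert (by simp),
        Finset.sum_insert (by simp), Finset.sum_singleton, h0, h01, h02, h12, hT]; ring
  have m_01_02_12_T : ∑ t ∈ ({![true, true, false], ![true, false, true], ![false, true, true], ![true, true,
      true]} : Finset (Fin 3 → Bool)), ν t = n01 + n02 + n12 + nT := by
    rw [Finset.sum_insert (by simp), Finset.sum_insert (by simp), Finset.sum_insert (by simp), Finset.sum_singleton,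
        h01, h02, h12, hT]; ring
  have m_1_01_02_12_T : ∑ t ∈ ({![false, true, false], ![true, true, false], ![true, false, true], ![false, true,
      true], ![true, true, true]} : Finset (Fin 3 → Bool)), ν t = n1 + n01 + n02 + n12 + nT := by
    rw [Finset.sum_insert (by simp), Finset.sum_insert (by simp), Finset.sum_insert (by simp),
        Finset.sum_insert (by simp), Finset.sum_singleton, h1, h01, h02, h12, hT]; ring
  have m_0_1_01_02_12_T : ∑ t ∈ ({![true, false, false], ![false, true, false], ![true, true, false], ![true, false,
      true], ![false, true, true], ![true, true, true]} : Finset (Fin 3 → Bool)),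
      ν t = n0 + n1 + n01 + n02 + n12 + nT := by
    rw [Finset.sum_insert (by simp), Finset.sum_insert (by simp), Finset.sum_insert (by simp),
        Finset.sum_insert (by simp), Finset.sum_insert (by simp), Finset.sum_singleton, h0, h1, h01, h02, h12,
        hT]; ring
  have m_02_12_T : ∑ t ∈ ({![true, false, true], ![false, true, true], ![true, true, true]} : Finset (Fin 3 → Bool)),
      ν t = n02 + n12 + nT := by
    rw [Finset.sum_insert (by simp), Finset.sum_insert (by simp), Finset.sum_singleton, h02, h12, hT]; ring
  have m_2_01_02_12_T : ∑ t ∈ ({![false, false, true], ![true, true, false], ![true, false, true], ![false, true,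
      true], ![true, true, true]} : Finset (Fin 3 → Bool)), ν t = n2 + n01 + n02 + n12 + nT := by
    rw [Finset.sum_insert (by simp), Finset.sum_insert (by simp), Finset.sum_insert (by simp),
        Finset.sum_insert (by simp), Finset.sum_singleton, h2, h01, h02, h12, hT]; ring
  have m_0_1_2_01_02_12_T : ∑ t ∈ ({![true, false, false], ![false, true, false], ![false, false, true], ![true,
      true, false], ![true, false, true], ![false, true, true], ![true, true, true]} : Finset (Fin 3 → Bool)),
      ν t = n0 + n1 + n2 + n01 + n02 + n12 + nT := by
    rw [Finset.sum_insert (by simp), Finset.sum_insert (by simp), Finset.sum_insert (by simp),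
        Finset.sum_insert (by simp), Finset.sum_insert (by simp), Finset.sum_insert (by simp), Finset.sum_singleton,
        h0, h1, h2, h01, h02, h12, hT]; ring
  have mD : ∑ t ∈ ({![true, false, false], ![false, true, false], ![false, false, true], ![true, true, false],
      ![true, false, true], ![false, true, true], ![true, true, true]} : Finset (Fin 3 → Bool))ᶜ, ν t = nE := by
    rw [hUc, Finset.sum_singleton, hE]
  refine ⟨hE ▸ hν0 _, h0 ▸ hν0 _, h1 ▸ hν0 _, h2 ▸ hν0 _, h01 ▸ hν0 _, h02 ▸ hν0 _, h12 ▸ hν0 _, hT ▸ hν0 _,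
      hZ ▸ Finset.sum_nonneg fun t _ => hν0 t, hsum, ?_, ?_, ?_, ?_, ?_, ?_, ?_, ?_, ?_, ?_, ?_, ?_, ?_, ?_, ?_, ?_,
      ?_, ?_⟩
  · have h := pt ![true, false, false] ![false, true, false] ![false, false, false] ![true, true,
      false] (by decide) (by decide)
    rwa [h0, h1, hE, h01] at h
  · have h := pt ![true, false, false] ![false, false, true] ![false, false, false] ![true, false,
      true] (by decide) (by decide)
    rwa [h0, h2, hE, h02] at h
  · have h := pt ![false, true, false] ![false, false, true] ![false, false, false] ![false, true,
      true] (by decide) (by decide)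
    rwa [h1, h2, hE, h12] at h
  · have h := fkg {![true, true, false], ![true, true, true]} {![false, false, true], ![true, false, true], ![false,
      true, true], ![true, true, true]} {![true, true, true]} (by decide) (by decide) (by decide)
    rwa [m_01_T, m_2_02_12_T, m_T] at h
  · have h := fkg {![true, false, true], ![true, true, true]} {![false, true, false], ![true, true, false], ![false,
      true, true], ![true, true, true]} {![true, true, true]} (by decide) (by decide) (by decide)
    rwa [m_02_T, m_1_01_12_T, m_T] at h
  · have h := fkg {![true, false, false], ![true, true, false], ![true, false, true], ![true, true, true]} {![false,
      true, true], ![true, true, true]} {![true, true, true]} (by decide) (by decide) (by decide)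
    rwa [m_0_01_02_T, m_12_T, m_T] at h
  · have h := fkg {![true, false, false], ![true, true, false], ![true, false, true], ![true, true, true]} {![false,
      true, false], ![true, true, false], ![false, true, true], ![true, true, true]} {![true, true, false], ![true,
      true, true]} (by decide) (by decide) (by decide)
    rwa [m_0_01_02_T, m_1_01_12_T, m_01_T] at h
  · have h := fkg {![true, false, false], ![true, true, false], ![true, false, true], ![true, true, true]} {![false,
      false, true], ![true, false, true], ![false, true, true], ![true, true, true]} {![true, false, true], ![true,
      true, true]} (by decide) (by decide) (by decide)
    rwa [m_0_01_02_T, m_2_02_12_T, m_02_T] at h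
  · have h := fkg {![true, false, false], ![true, true, false], ![true, false, true], ![true, true, true]} {![false,
      true, false], ![false, false, true], ![true, true, false], ![true, false, true], ![false, true, true], ![true,
      true, true]} {![true, true, false], ![true, false, true], ![true, true,
      true]} (by decide) (by decide) (by decide)
    rwa [m_0_01_02_T, m_1_2_01_02_12_T, m_01_02_T] at h
  · have h := fkg {![false, true, false], ![true, true, false], ![false, true, true], ![true, true, true]} {![false,
      false, true], ![true, false, true], ![false, true, true], ![true, true, true]} {![false, true, true], ![true,
      true, true]} (by decide) (by decide) (by decide)
    rwa [m_1_01_12_T, m_2_02_12_T, m_12_T] at h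
  · have h := fkg {![false, true, false], ![true, true, false], ![false, true, true], ![true, true, true]} {![true,
      false, false], ![false, false, true], ![true, true, false], ![true, false, true], ![false, true, true], ![true,
      true, true]} {![true, true, false], ![false, true, true], ![true, true,
      true]} (by decide) (by decide) (by decide)
    rwa [m_1_01_12_T, m_0_2_01_02_12_T, m_01_12_T] at h
  · have h := fkg {![true, false, false], ![true, true, false], ![true, false, true], ![false, true, true], ![true,
      true, true]} {![false, true, false], ![false, false, true], ![true, true, false], ![true, false, true],
      ![false, true, true], ![true, true, true]} {![true, true, false], ![true, false, true], ![false, true, true],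
      ![true, true, true]} (by decide) (by decide) (by decide)
    rwa [m_0_01_02_12_T, m_1_2_01_02_12_T, m_01_02_12_T] at h
  · have h := fkg {![false, true, false], ![true, true, false], ![true, false, true], ![false, true, true], ![true,
      true, true]} {![true, false, false], ![false, false, true], ![true, true, false], ![true, false, true],
      ![false, true, true], ![true, true, true]} {![true, true, false], ![true, false, true], ![false, true, true],
      ![true, true, true]} (by decide) (by decide) (by decide)
    rwa [m_1_01_02_12_T, m_0_2_01_02_12_T, m_01_02_12_T] at h
  · have h := fkg {![true, false, false], ![false, true, false], ![true, true, false], ![true, false, true], ![false,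
      true, true], ![true, true, true]} {![false, false, true], ![true, false, true], ![false, true, true], ![true,
      true, true]} {![true, false, true], ![false, true, true], ![true, true,
      true]} (by decide) (by decide) (by decide)
    rwa [m_0_1_01_02_12_T, m_2_02_12_T, m_02_12_T] at h
  · have h := fkg {![true, false, false], ![false, true, false], ![true, true, false], ![true, false, true], ![false,
      true, true], ![true, true, true]} {![false, false, true], ![true, true, false], ![true, false, true], ![false,
      true, true], ![true, true, true]} {![true, true, false], ![true, false, true], ![false, true, true], ![true,
      true, true]} (by decide) (by decide) (by decide)
    rwa [m_0_1_01_02_12_T, m_2_01_02_12_T, m_01_02_12_T] at h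
  · have h := fkg {![true, false, false], ![false, true, false], ![true, true, false], ![true, false, true], ![false,
      true, true], ![true, true, true]} {![true, false, false], ![false, false, true], ![true, true, false], ![true,
      false, true], ![false, true, true], ![true, true, true]} {![true, false, false], ![true, true, false], ![true,
      false, true], ![false, true, true], ![true, true, true]} (by decide) (by decide) (by decide)
    rwa [m_0_1_01_02_12_T, m_0_2_01_02_12_T, m_0_01_02_12_T] at h
  · have h := fkg {![true, false, false], ![false, true, false], ![true, true, false], ![true, false, true], ![false,
      true, true], ![true, true, true]} {![false, true, false], ![false, false, true], ![true, true, false], ![true,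
      false, true], ![false, true, true], ![true, true, true]} {![false, true, false], ![true, true, false], ![true,
      false, true], ![false, true, true], ![true, true, true]} (by decide) (by decide) (by decide)
    rwa [m_0_1_01_02_12_T, m_1_2_01_02_12_T, m_1_01_02_12_T] at h
  · have h := fkg {![true, false, false], ![false, false, true], ![true, true, false], ![true, false, true], ![false,
      true, true], ![true, true, true]} {![false, true, false], ![false, false, true], ![true, true, false], ![true,
      false, true], ![false, true, true], ![true, true, true]} {![false, false, true], ![true, true, false], ![true,
      false, true], ![false, true, true], ![true, true, true]} (by decide) (by decide) (by decide)
    rwa [m_0_2_01_02_12_T, m_1_2_01_02_12_T, m_2_01_02_12_T] at h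

end Summit.CriticalPhenomena.PercolationContinuityZ3.Theorems.SahiE3Hit3Pattern
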